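import Literature.Computability.AlgebraicComplexity.STPPTranslation
import Literature.Computability.AlgebraicComplexity.STPPGlobalShift
import Literature.Computability.AlgebraicComplexity.STPPMapHom
import Literature.Computability.AlgebraicComplexity.STPPLineFamilies
import HarnessLib

/-!
# STPP families: the X-ROOM SET `⋃ⱼₗ ((Bⱼ − Cⱼ) + (C_l − A_l))` and the ROOM LAW for a further triple (any abelian group)

Cell `pub-omega` (unit `pub-omega-stpp-1-g35`), topic `Summits/MatrixMultiplication/OmegaCensus`.
HONEST FRAMING (verbatim): lottery ticket; floor = certified bounds/negative ranges. Census STRUCTURE bookkeeping (the threshold column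
`T1(H) = max {k : (2,1,1)^k ⊆ H}` and the ROOM mechanism of X-38 / Pb230); nothing here is a bound on `ω`.

Write `Xᵢ = Aᵢ − Bᵢ`, `Yⱼ = Bⱼ − Cⱼ`, `Z_l = C_l − A_l`. The STPP word of CKSU Def. 5.1 is `x + y + z = 0` with `x ∈ Xᵢ`, `y ∈ Yⱼ`, `z ∈ Z_l`
forcing `i = j = l`. Hence (**room law, X-class**): for a family of `k + 2` triples, the set `B_last − A_last = −X_last` is DISJOINT from the
X-ROOM SET `roomX := ⋃_{j,l < last} (Yⱼ + Z_l)` of the first `k + 1` triples (`disjoint_roomX_init`), and it has `#B_last · #A_last` elements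
(`card_sub_BA`), so `#roomX(first k+1) + #B_last · #A_last ≤ |G|` (`room_law`) and a family whose first `k + 1` triples have
`roomX = univ` does not exist (`no_extension_of_roomX_eq_univ`). The (1,2,2)-pattern twin (Y-class, over `(ℤ/p)³`) is
`GLNF.room_law` / `Rank3Cert.no_fourth_block` (`STPP122RankThreeRoomCorollary`). Also: `#roomX` is invariant under the census symmetries
(per-member translation `roomX_translate`, global shifts `roomX_shiftBC`, injective homomorphisms `roomX_map`, re-indexing `roomX_reindex`).
General `G`, general cards; used by the `(2,1,1)⁶ ⊆ (ℤ/2)⁵` room certificate (T1((ℤ/2)⁵) = 6 by room).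

References: H. Cohn, R. Kleinberg, B. Szegedy, C. Umans, FOCS 2005 (arXiv:math/0511460), Def. 5.1.
-/

namespace Summit.MatrixMultiplication.OmegaCensus

namespace T1Room

open Finset Pointwise Literature.Computability.AlgebraicComplexity

variable {G : Type*} [AddCommGroup G] [DecidableEq G] {k : ℕ}

/-! ## The X-room set -/

/-- The X-ROOM SET of a family: `⋃ⱼ ⋃ₗ ((Bⱼ − Cⱼ) + (C_l − A_l))`. A further triple `(A', B', C')` extending the family to an STPP family
must have `B' − A'` inside the complement. -/
def roomX (A B C : Fin (k + 1) → Finset G) : Finset G :=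
  univ.biUnion fun j => univ.biUnion fun l => (B j - C j) + (C l - A l)

/-- Membership in the X-room set. -/
theorem mem_roomX {A B C : Fin (k + 1) → Finset G} {x : G} :
    x ∈ roomX A B C ↔ ∃ j l, ∃ b ∈ B j, ∃ c ∈ C j, ∃ c' ∈ C l, ∃ a ∈ A l, x = (b - c) + (c' - a) := by
  simp only [roomX, mem_biUnion, mem_univ, true_and, mem_add, mem_sub]
  constructor
  · rintro ⟨j, l, _, ⟨b, hb, c, hc, rfl⟩, _, ⟨c', hc', a, ha, rfl⟩, rfl⟩
    exact ⟨j, l, b, hb, c, hc, c', hc', a, ha, rfl⟩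
  · rintro ⟨j, l, b, hb, c, hc, c', hc', a, ha, rfl⟩
    exact ⟨j, l, _, ⟨b, hb, c, hc, rfl⟩, _, ⟨c', hc', a, ha, rfl⟩, rfl⟩

/-- Monotonicity: the X-room set of the first `k + 1` triples is inside that of all `k + 2`. -/
theorem roomX_mono {A B C : Fin (k + 2) → Finset G} :
    roomX (fun i : Fin (k + 1) => A i.castSucc) (fun i => B i.castSucc) (fun i => C i.castSucc) ⊆ roomX A B C := by
  intro x hx
  obtain ⟨j, l, b, hb, c, hc, c', hc', a, ha, rfl⟩ := mem_roomX.1 hx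
  exact mem_roomX.2 ⟨j.castSucc, l.castSucc, b, hb, c, hc, c', hc', a, ha, rfl⟩

/-! ## The room law (X-class) -/

/-- **Disjointness (X-class room law).** In an STPP family of `k + 2` triples, `B_last − A_last` misses the X-room set of the first `k + 1`
triples: `(b − c) + (c' − a) = b' − a'` (`b ∈ Bⱼ, c ∈ Cⱼ, c' ∈ C_l, a ∈ A_l, b' ∈ B_last, a' ∈ A_last`) is the STPP word
`(a' − a) + (b − b') + (c' − c) = 0` with index pattern `(last, j, l)`, forcing `last = j`. [cite: CohnKleinbergSzegedyUmans2005, Def. 5.1] -/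
theorem disjoint_roomX_init {A B C : Fin (k + 2) → Finset G} (hS : IsSTPP A B C) :
    Disjoint (roomX (fun i : Fin (k + 1) => A i.castSucc) (fun i => B i.castSucc) (fun i => C i.castSucc))
      (B (Fin.last (k + 1)) - A (Fin.last (k + 1))) := by
  rw [Finset.disjoint_left]
  intro x hx hx'
  obtain ⟨j, l, b, hb, c, hc, c', hc', a, ha, rfl⟩ := mem_roomX.1 hx
  obtain ⟨b', hb', a', ha', he⟩ := mem_sub.1 hx'
  have h := hS (Fin.last (k + 1)) j.castSucc l.castSucc a ha a' ha' b' hb' b hb c hc c' hc'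
    (by rw [← sub_eq_zero.2 he.symm]; abel)
  exact (Fin.castSucc_lt_last j).ne h.1.symm

/-- **TPP count:** in an STPP family `#(Bᵢ − Aᵢ) = #Bᵢ · #Aᵢ` whenever `Cᵢ` is non-empty (word `(a' − a) + (b − b') + (c − c) = 0`).
[cite: CohnKleinbergSzegedyUmans2005, Def. 5.1] -/
theorem card_sub_BA {N : ℕ} {A B C : Fin N → Finset G} (hS : IsSTPP A B C) (i : Fin N) (hC : (C i).Nonempty) :
    (B i - A i).card = (B i).card * (A i).card := by
  obtain ⟨c, hc⟩ := hC
  rw [Finset.sub_def, card_image_of_injOn, card_product]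
  rintro ⟨b, a⟩ hba ⟨b', a'⟩ hba' (he : b - a = b' - a')
  rw [coe_product, Set.mem_prod, mem_coe, mem_coe] at hba hba'
  obtain ⟨-, -, haa, hbb, -⟩ := hS i i i a hba.2 a' hba'.2 b' hba'.1 b hba.1 c hc c hc
    (by rw [sub_self, add_zero, ← sub_eq_zero.2 he]; abel)
  rw [haa, hbb]

/-- **ROOM LAW (X-class).** For an STPP family of `k + 2` triples of a finite abelian group whose last `C`-set is non-empty,
`#roomX(first k + 1 triples) + #B_last · #A_last ≤ |G|`. [cite: CohnKleinbergSzegedyUmans2005, Def. 5.1] -/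
theorem room_law [Fintype G] {A B C : Fin (k + 2) → Finset G} (hS : IsSTPP A B C) (hC : (C (Fin.last (k + 1))).Nonempty) :
    (roomX (fun i : Fin (k + 1) => A i.castSucc) (fun i => B i.castSucc) (fun i => C i.castSucc)).card +
      (B (Fin.last (k + 1))).card * (A (Fin.last (k + 1))).card ≤ Fintype.card G := by
  rw [← card_sub_BA hS (Fin.last (k + 1)) hC, ← card_union_of_disjoint (disjoint_roomX_init hS)]
  exact card_le_univ _

/-- **No extension of a family with full X-room:** if the first `k + 1` triples of an STPP family of `k + 2` triples have
`roomX = univ`, the last triple has an empty `A`- or `B`-set. [cite: CohnKleinbergSzegedyUmans2005, Def. 5.1] -/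
theorem no_extension_of_roomX_eq_univ [Fintype G] {A B C : Fin (k + 2) → Finset G} (hS : IsSTPP A B C)
    (hroom : roomX (fun i : Fin (k + 1) => A i.castSucc) (fun i => B i.castSucc) (fun i => C i.castSucc) = univ)
    (hA : (A (Fin.last (k + 1))).Nonempty) (hB : (B (Fin.last (k + 1))).Nonempty) : False := by
  obtain ⟨a, ha⟩ := hA
  obtain ⟨b, hb⟩ := hB
  have hmem : b - a ∈ B (Fin.last (k + 1)) - A (Fin.last (k + 1)) := sub_mem_sub hb ha
  exact Finset.disjoint_left.1 (disjoint_roomX_init hS) (hroom ▸ mem_univ (b - a)) hmem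

/-! ## Invariance of the X-room set under the census symmetries -/

/-- Translating both sets by the same vector does not change their difference set. -/
theorem image_add_sub_image_add (s t : Finset G) (v : G) : s.image (· + v) - t.image (· + v) = s - t := by
  ext x
  simp only [mem_sub, mem_image]
  constructor
  · rintro ⟨_, ⟨b, hb, rfl⟩, _, ⟨c, hc, rfl⟩, rfl⟩
    exact ⟨b, hb, c, hc, by abel⟩
  · rintro ⟨b, hb, c, hc, rfl⟩
    exact ⟨b + v, ⟨b, hb, rfl⟩, c + v, ⟨c, hc, rfl⟩, by abel⟩

/-- Translating the first set translates the difference set. -/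
theorem image_add_sub (s t : Finset G) (v : G) : s.image (· + v) - t = (s - t).image (· + v) := by
  ext x
  simp only [mem_sub, mem_image]
  constructor
  · rintro ⟨_, ⟨b, hb, rfl⟩, c, hc, rfl⟩
    exact ⟨b - c, ⟨b, hb, c, hc, rfl⟩, by abel⟩
  · rintro ⟨_, ⟨b, hb, c, hc, rfl⟩, rfl⟩
    exact ⟨b + v, ⟨b, hb, rfl⟩, c, hc, by abel⟩

/-- Translating the second set translates the difference set backwards. -/
theorem sub_image_add (s t : Finset G) (v : G) : s - t.image (· + v) = (s - t).image (· + -v) := by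
  ext x
  simp only [mem_sub, mem_image]
  constructor
  · rintro ⟨b, hb, _, ⟨c, hc, rfl⟩, rfl⟩
    exact ⟨b - c, ⟨b, hb, c, hc, rfl⟩, by abel⟩
  · rintro ⟨_, ⟨b, hb, c, hc, rfl⟩, rfl⟩
    exact ⟨b, hb, c + v, ⟨c, hc, rfl⟩, by abel⟩

/-- Sum of two translates. -/
theorem image_add_add_image_add (s t : Finset G) (v w : G) : s.image (· + v) + t.image (· + w) = (s + t).image (· + (v + w)) := by
  ext x
  simp only [mem_add, mem_image]
  constructor
  · rintro ⟨_, ⟨b, hb, rfl⟩, _, ⟨c, hc, rfl⟩, rfl⟩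
    exact ⟨b + c, ⟨b, hb, c, hc, rfl⟩, by abel⟩
  · rintro ⟨_, ⟨b, hb, c, hc, rfl⟩, rfl⟩
    exact ⟨b + v, ⟨b, hb, rfl⟩, c + w, ⟨c, hc, rfl⟩, by abel⟩

/-- **Per-member translation leaves the X-room set unchanged.** -/
theorem roomX_translate (A B C : Fin (k + 1) → Finset G) (t : Fin (k + 1) → G) :
    roomX (fun i => (A i).image (· + t i)) (fun i => (B i).image (· + t i)) (fun i => (C i).image (· + t i)) = roomX A B C := by
  simp only [roomX, image_add_sub_image_add]

/-- Shifting the two sets independently shifts the difference set by the difference of the shifts. -/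
theorem image_add_sub_image_add' (s t : Finset G) (v w : G) :
    s.image (· + v) - t.image (· + w) = (s - t).image (· + (v - w)) := by
  ext x
  simp only [mem_sub, mem_image]
  constructor
  · rintro ⟨_, ⟨b, hb, rfl⟩, _, ⟨c, hc, rfl⟩, rfl⟩
    exact ⟨b - c, ⟨b, hb, c, hc, rfl⟩, by abel⟩
  · rintro ⟨_, ⟨b, hb, c, hc, rfl⟩, rfl⟩
    exact ⟨b + v, ⟨b, hb, rfl⟩, c + w, ⟨c, hc, rfl⟩, by abel⟩

/-- **The global `B`/`C` shifts translate the X-room set** by `β`. -/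
theorem roomX_shiftBC (A B C : Fin (k + 1) → Finset G) (β γ : G) :
    roomX A (fun i => (B i).image (· + β)) (fun i => (C i).image (· + γ)) = (roomX A B C).image (· + β) := by
  have h1 : ∀ j, (B j).image (· + β) - (C j).image (· + γ) = (B j - C j).image (· + (β - γ)) := fun j =>
    image_add_sub_image_add' _ _ _ _
  have h2 : ∀ l, (C l).image (· + γ) - A l = (C l - A l).image (· + γ) := fun l => image_add_sub _ _ _
  have h3 : ∀ j l, (B j - C j).image (· + (β - γ)) + (C l - A l).image (· + γ) = ((B j - C j) + (C l - A l)).image (· + β) :=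
    fun j l => by rw [image_add_add_image_add, sub_add_cancel]
  unfold roomX
  simp_rw [h1, h2, h3, ← biUnion_image]

/-- Cardinality form of `roomX_shiftBC`. -/
theorem card_roomX_shiftBC (A B C : Fin (k + 1) → Finset G) (β γ : G) :
    (roomX A (fun i => (B i).image (· + β)) (fun i => (C i).image (· + γ))).card = (roomX A B C).card := by
  rw [roomX_shiftBC, card_image_of_injective _ (add_left_injective _)]

/-- A homomorphism maps difference sets to difference sets. -/
theorem image_sub_hom {G' : Type*} [AddCommGroup G'] [DecidableEq G'] (φ : G →+ G') (s t : Finset G) :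
    (s - t).image φ = s.image φ - t.image φ :=
  image_image₂_distrib (map_sub φ)

/-- A homomorphism maps sumsets to sumsets. -/
theorem image_add_hom {G' : Type*} [AddCommGroup G'] [DecidableEq G'] (φ : G →+ G') (s t : Finset G) :
    (s + t).image φ = s.image φ + t.image φ :=
  image_image₂_distrib (map_add φ)

/-- **An injective homomorphism maps the X-room set to the X-room set of the image family.** -/
theorem roomX_map {G' : Type*} [AddCommGroup G'] [DecidableEq G'] (A B C : Fin (k + 1) → Finset G) (φ : G →+ G') :
    roomX (fun i => (A i).image φ) (fun i => (B i).image φ) (fun i => (C i).image φ) = (roomX A B C).image φ := by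
  simp only [roomX, biUnion_image, image_add_hom, image_sub_hom]

/-- Cardinality form of `roomX_map` for injective `φ`. -/
theorem card_roomX_map {G' : Type*} [AddCommGroup G'] [DecidableEq G'] (A B C : Fin (k + 1) → Finset G) (φ : G →+ G')
    (hφ : Function.Injective φ) :
    (roomX (fun i => (A i).image φ) (fun i => (B i).image φ) (fun i => (C i).image φ)).card = (roomX A B C).card := by
  rw [roomX_map, card_image_of_injective _ hφ]

/-- **Re-indexing by a bijection leaves the X-room set unchanged.** -/
theorem roomX_reindex (A B C : Fin (k + 1) → Finset G) (σ : Fin (k + 1) ≃ Fin (k + 1)) :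
    roomX (fun i => A (σ i)) (fun i => B (σ i)) (fun i => C (σ i)) = roomX A B C := by
  ext x
  simp only [mem_roomX]
  constructor
  · rintro ⟨j, l, b, hb, c, hc, c', hc', a, ha, rfl⟩
    exact ⟨σ j, σ l, b, hb, c, hc, c', hc', a, ha, rfl⟩
  · rintro ⟨j, l, b, hb, c, hc, c', hc', a, ha, rfl⟩
    refine ⟨σ.symm j, σ.symm l, b, ?_, c, ?_, c', ?_, a, ?_, rfl⟩ <;> simpa

/-- In a finite group, `roomX = univ` iff `#roomX = |G|`. -/
theorem roomX_eq_univ_iff_card [Fintype G] (A B C : Fin (k + 1) → Finset G) :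
    roomX A B C = univ ↔ (roomX A B C).card = Fintype.card G :=
  ⟨fun h => by rw [h, card_univ], fun h => eq_univ_of_card _ h⟩

end T1Room

end Summit.MatrixMultiplication.OmegaCensus
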